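import Summits.ResolutionOfSingularities.ResolutionOfSingularities.Theorems.WildQuotientsSummitReductionStubPairOrbitNormalFormBlowupModelSing3
import Summits.ResolutionOfSingularities.ResolutionOfSingularities.Theorems.WildQuotientsSummitReductionStubPairOrbitNormalFormBlowupLemmas
import Literature.AlgebraicGeometry.Resolution.AlterationsNormalFormCentreFormalIdealProofs
import Literature.AlgebraicGeometry.Resolution.BoundarySplitting
import HarnessLib

/-!
# `WildQuotients.SummitReduction` (stmt-ResolutionOfSingularities-16324), line `FramePerfect`, stub S
# (`stub_pair_orbitNormalFormBlowup`): the completed ideals of the singular components through a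
# closed point of a `QuasiSplitNormalFormPair` are the centre ideals `(u, v, t_a, t_b)`

Route `ResolutionOfSingularities/WildQuotients`, crux `SummitReduction`; helper file of the line
skeleton (v8), stub S = the orbit version of de Jong 1996, Claim 4.27 for
`DeJong1997.QuasiSplitNormalFormPair`. This is the COEFFICIENT-FREE, EQUIVARIANT form of [S1] of
4.27 (de Jong 1996, p. 75: "Since `E` is smooth, its ideal in the rings of (ii) is given by
`(u, v, t₁, t₂)` after renumbering"; tree, over an algebraically closed field:
`DeJong1996NormalFormPairCentreFormalIdeal_holds`), the first input of every chart computation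
over the centre (the sub-goals O1–O3 of `quasiSplitNormalFormPair_blowup_of_overCentre`):

* `stalkIdeal_vanishingIdeal_orbit_eq` — near a point of a component `E'` of `Sing X` the orbit
  `⋃_g ρ(g)(E')` IS `E'` (the other translates are closed and miss the point, by the disjointness
  `quasiSplitNormalFormPair_translate_eq_of_mem_of_mem`), so the two vanishing ideal sheaves have
  the same stalk;
* `quasiSplitNormalFormPair_centreFormalIdeal` — at a singular closed point `x`, with the model
  `e : 𝒪̂_{X,x} ≅ A⟦u, v⟧/(uv - ∏_{i<s} tᵢ)` of field 4.25 (ii): the completed ideal of every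
  irreducible component `E' ∋ x` of `Sing X` is carried by `e` to
  `𝔭_{ab} = (t_a, t_b) + (u, v)` for a unique pair `a < b < s`, and every `𝔭_{ab}` so arises.
  The proof is that of `DeJong1996NormalFormPairCentreFormalIdeal_holds` (regular formal fibres
  of `𝒪_{X,x}`, EGA IV₂ 7.8.3 (v); faithful flatness of the completion; generic points of the
  components through `x`) with the algebra of the model supplied coefficient-free by the sibling
  files `…ModelSing{,2,3}.lean`, and the primality of the completed ideal of `E'` obtained from
  the regularity of the reduced ORBIT of `E'` (field `isRegular_subscheme_orbit`);
* `quasiSplitNormalFormPair_centreFormalIdeal_orbit` — in particular the completed ideal of the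
  orbit centre `closure (⋃_g ρ(g)(E))` at a closed point `x` of it is some `𝔭_{ab}`.

## Sources

* A. J. de Jong, *Smoothness, semi-stability and alterations*, Publ. Math. IHÉS 83 (1996), 3.5
  (p. 64), 4.27 (p. 75). [DeJong1996]
* A. J. de Jong, *Families of curves and alterations*, Ann. Inst. Fourier 47 (1997), proof of
  Prop. 5.11, p. 619. [DeJong1997]
* H. Matsumura, *Commutative Ring Theory* (1986), Thm. 8.11, 8.14, 14.3, §32. [Matsumura1987]
-/

set_option linter.dupNamespace false -- the tree's summit namespace repeats `ResolutionOfSingularities`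

noncomputable section

open CategoryTheory CategoryTheory.Limits AlgebraicGeometry TopologicalSpace Topology
open Literature.AlgebraicGeometry.Resolution
open Literature.AlgebraicGeometry
open IsLocalRing Scheme.IdealSheafData

namespace Summit.ResolutionOfSingularities.ResolutionOfSingularities.Theorems

/-! ## The orbit of a component near one of its points -/

/-- **Near a point of a component `E'` of `Sing X`, the orbit of `E'` is `E'`**: for a
`QuasiSplitNormalFormPair`, the stalks at `x ∈ E'` of the vanishing ideal sheaves of
`closure (⋃_g ρ(g)(E'))` and of `E'` coincide (the other translates are finitely many closed
sets missing `x`). [cite: DeJong1997, proof of Prop. 5.11, p. 619] -/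
theorem stalkIdeal_vanishingIdeal_orbit_eq {k : Type} [Field k] {X : Scheme.{0}}
    {p : X ⟶ Spec (.of k)} {Z : Set X} {G : Type} [Group G] [Finite G] {ρ : G →* Aut X} {d : ℕ}
    (h : DeJong1997.QuasiSplitNormalFormPair p Z ρ d)
    {E : Set ↥({x : X | ¬ IsRegularLocalRing (X.presheaf.stalk x)} : Set X)}
    (hE : E ∈ irreducibleComponents ↥({x : X | ¬ IsRegularLocalRing (X.presheaf.stalk x)} : Set X))
    {x : X} (hx : x ∈ Subtype.val '' E) :
    stalkIdeal (vanishingIdeal ⟨closure (⋃ g : G, (ρ g).hom.base '' (Subtype.val '' E)),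
        isClosed_closure⟩) x =
      stalkIdeal (vanishingIdeal ⟨Subtype.val '' E,
        isClosed_image_val_of_mem_irreducibleComponents h.isClosed_setOf_not_isRegularLocalRing hE⟩)
        x := by
  have hS := h.isClosed_setOf_not_isRegularLocalRing
  have hE₀c := isClosed_image_val_of_mem_irreducibleComponents hS hE
  -- the open complement of the other translates
  let B : Set X := ⋃ g ∈ {g : G | (ρ g).hom.base '' (Subtype.val '' E) ≠ Subtype.val '' E},
    (ρ g).hom.base '' (Subtype.val '' E)
  have hBc : IsClosed B :=
    (Set.toFinite _).isClosed_biUnion fun g _ => (Scheme.homeoOfIso (ρ g)).isClosedMap _ hE₀c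
  have hxB : x ∉ B := by
    intro hxB
    obtain ⟨g, hg, hxg⟩ := Set.mem_iUnion₂.mp hxB
    apply hg
    have h1 := quasiSplitNormalFormPair_translate_eq_of_mem_of_mem h hE (g := g) (g' := 1) hxg
      (by rw [map_one]; exact ⟨x, hx, rfl⟩)
    rw [h1, map_one]
    ext y
    exact ⟨by rintro ⟨z, hz, rfl⟩; exact hz, fun hy => ⟨y, hy, rfl⟩⟩
  refine stalkIdeal_vanishingIdeal_congr ⟨Bᶜ, hBc.isOpen_compl⟩ hxB ?_
  change closure (⋃ g : G, (ρ g).hom.base '' (Subtype.val '' E)) ∩ Bᶜ = Subtype.val '' E ∩ Bᶜ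
  rw [quasiSplitNormalFormPair_closure_orbit_eq h hE]
  refine Set.Subset.antisymm ?_ (Set.inter_subset_inter_left _
    (Set.subset_iUnion (fun g : G => (ρ g).hom.base '' (Subtype.val '' E)) 1 |>.trans' (by
      rw [map_one]
      intro y hy
      exact ⟨y, hy, rfl⟩)))
  rintro y ⟨hy, hyB⟩
  obtain ⟨g, hyg⟩ := Set.mem_iUnion.mp hy
  refine ⟨?_, hyB⟩
  by_contra hyE
  refine hyB (Set.mem_iUnion₂.mpr ⟨g, fun hgE => ?_, hyg⟩)
  rw [hgE] at hyg
  exact hyE hyg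

/-! ## The completed ideals of the singular components through a closed point -/

/-- **The completed ideals of the components of `Sing X` through a singular closed point of a
`QuasiSplitNormalFormPair` are the centre ideals `𝔭_{ab} = (t_a, t_b) + (u, v)`, `a < b < s`, of
the model `A⟦u, v⟧/(uv - ∏_{i<s} tᵢ)`** (de Jong 1996, 4.27 [S1] with the dictionary of 3.5,
coefficient-free and for orbits): together with the model `e` of field 4.25 (ii) at `x` and the
completed ideal of `Z`, (1) for every irreducible component `E' ∋ x` of `Sing X` there are
`a < b < s` with `e(Î_{E'}) = 𝔭_{ab}`, and (2) every `𝔭_{ab}`, `a < b < s`, is `e(Î_{E''})` for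
some component `E'' ∋ x`. Proof as in `DeJong1996NormalFormPairCentreFormalIdeal_holds`: (α)
`Î_{E'}` is prime — the stalk of `I(E')` at `x` is that of the ideal of the ORBIT of `E'`
(`stalkIdeal_vanishingIdeal_orbit_eq`), whose reduced subscheme is regular, and the completion
of the regular `𝒪_{X,x}/I(E')_x` is a domain — and `V(Î_{E'}) ⊆ Sing(𝒪̂)` (regular formal
fibres, EGA IV₂ 7.8.3 (v)), so `e(Î_{E'}) ⊇ 𝔭_{ab}` for some `a < b < s`
(`exists_mem_of_not_isRegularLocalRing_nodeDeformationRing`); (β) `e⁻¹ 𝔭_{ab}` is a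
non-regular prime (`not_isRegularLocalRing_localization_nodeDeformationRing`), so it contracts
to a non-regular point of `X` generising `x`, on a component `E''` with
`𝔭_{a'b'} ⊆ e(Î_{E''}) ⊆ 𝔭_{ab}`, forcing `(a', b') = (a, b)` (`eq_of_centreIdeal_le`); (γ)
faithful flatness and generic points give `E' = E''`.
[cite: DeJong1996, 4.27, p. 75] [cite: DeJong1997, proof of Prop. 5.11, p. 619] -/
theorem quasiSplitNormalFormPair_centreFormalIdeal {k : Type} [Field k] {X : Scheme.{0}}
    {p : X ⟶ Spec (.of k)} {Z : Set X} {G : Type} [Group G] [Finite G] {ρ : G →* Aut X} {d : ℕ}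
    (h : DeJong1997.QuasiSplitNormalFormPair p Z ρ d) {x : X} (hxc : IsClosed ({x} : Set X))
    (hxS : ¬ IsRegularLocalRing (X.presheaf.stalk x)) :
    ∃ (A : Type) (_ : CommRing A) (_ : IsRegularLocalRing A) (t : Fin (d - 1) → A) (s r : ℕ),
      Ideal.span (Set.range t) = maximalIdeal A ∧ ringKrullDim A = (d - 1 : ℕ) ∧
      2 ≤ s ∧ s ≤ r ∧ r ≤ d - 1 ∧
      ∃ e : AdicCompletion (maximalIdeal (X.presheaf.stalk x)) (X.presheaf.stalk x) ≃+*
          DeJong1996.NodeDeformationRing A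
            (∏ i ∈ Finset.univ.filter (fun i : Fin (d - 1) => i.val < s), t i),
        (∀ (U : X.affineOpens) (hU : x ∈ (U : X.Opens)),
          (completedStalkIdeal (vanishingIdeal ⟨Z, h.isClosed⟩) x U hU).map e.toRingHom =
            Ideal.span {DeJong1996.NodeDeformationRing.ofBase A _
              (∏ i ∈ Finset.univ.filter (fun i : Fin (d - 1) => i.val < r), t i)}) ∧
        (∀ E' ∈ componentsIn ({x : X | ¬ IsRegularLocalRing (X.presheaf.stalk x)} : Set X),
          x ∈ E' → ∃ a b : Fin (d - 1), a < b ∧ b.val < s ∧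
            ∀ (U : X.affineOpens) (hU : x ∈ (U : X.Opens)),
              (completedStalkIdeal (vanishingIdeal ⟨closure E', isClosed_closure⟩) x U hU).map
                e.toRingHom =
              (Ideal.span {t a, t b}).map (DeJong1996.NodeDeformationRing.ofBase A _) ⊔
                Ideal.span {Ideal.Quotient.mk _ (MvPowerSeries.X 0),
                  Ideal.Quotient.mk _ (MvPowerSeries.X 1)}) ∧
        (∀ a b : Fin (d - 1), a < b → b.val < s →
          ∃ E'' ∈ componentsIn ({x : X | ¬ IsRegularLocalRing (X.presheaf.stalk x)} : Set X),
            x ∈ E'' ∧ ∀ (U : X.affineOpens) (hU : x ∈ (U : X.Opens)),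
              (completedStalkIdeal (vanishingIdeal ⟨closure E'', isClosed_closure⟩) x U hU).map
                e.toRingHom =
              (Ideal.span {t a, t b}).map (DeJong1996.NodeDeformationRing.ofBase A _) ⊔
                Ideal.span {Ideal.Quotient.mk _ (MvPowerSeries.X 0),
                  Ideal.Quotient.mk _ (MvPowerSeries.X 1)}) := by
  -- adapted from `DeJong1996NormalFormPairCentreFormalIdeal_holds` (AlterationsNormalFormCentreFormalIdealProofs.lean)
  classical
  let S : Set X := {x : X | ¬ IsRegularLocalRing (X.presheaf.stalk x)}
  have hS : IsClosed S := h.isClosed_setOf_not_isRegularLocalRing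
  haveI := h.isIntegral
  haveI := h.locallyOfFiniteType
  haveI : IsNoetherian X := h.isNoetherian
  -- 4.25 (ii) at `x`
  obtain ⟨A, _, _, t, s, r, hspan, hdim, hs2, hsr, hrd, e, hZ⟩ :=
    h.exists_ringEquiv_of_not_isRegularLocalRing x hxc hxS
  refine ⟨A, _, ‹_›, t, s, r, hspan, hdim, hs2, hsr, hrd, e, hZ, ?_⟩
  -- the model and its centre ideals
  generalize hhprod : (∏ i ∈ Finset.univ.filter (fun i : Fin (d - 1) => i.val < s), t i) = hprod
    at e hZ ⊢
  let 𝔭 : Fin (d - 1) → Fin (d - 1) → Ideal (DeJong1996.NodeDeformationRing A hprod) := fun a b =>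
    (Ideal.span {t a, t b}).map (DeJong1996.NodeDeformationRing.ofBase A _) ⊔
      Ideal.span {Ideal.Quotient.mk _ (MvPowerSeries.X 0), Ideal.Quotient.mk _ (MvPowerSeries.X 1)}
  have hmem_pair : ∀ {a b : Fin (d - 1)}, a.val < s → hprod ∈ Ideal.span {t a, t b} := by
    intro a b has
    have ha : a ∈ Finset.univ.filter (fun i : Fin (d - 1) => i.val < s) := by simp [has]
    rw [← hhprod, ← Finset.mul_prod_erase _ _ ha]
    exact Ideal.mul_mem_right _ _ (Ideal.subset_span (by simp))
  have hdvd_pair : ∀ {a b : Fin (d - 1)}, a ≠ b → a.val < s → b.val < s → t a * t b ∣ hprod := by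
    intro a b hab has hbs
    have ha : a ∈ Finset.univ.filter (fun i : Fin (d - 1) => i.val < s) := by simp [has]
    have hb : b ∈ (Finset.univ.filter (fun i : Fin (d - 1) => i.val < s)).erase a :=
      Finset.mem_erase.mpr ⟨hab.symm, by simp [hbs]⟩
    rw [← hhprod, ← Finset.mul_prod_erase _ _ ha, ← Finset.mul_prod_erase _ _ hb, ← mul_assoc]
    exact Dvd.intro _ rfl
  -- the algebra of the model (`…ModelSing{,2,3}.lean`)
  have hSing₁ : ∀ (𝔮 : Ideal (DeJong1996.NodeDeformationRing A hprod)) [𝔮.IsPrime],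
      ¬ IsRegularLocalRing (Localization.AtPrime 𝔮) →
        ∃ a b : Fin (d - 1), a < b ∧ b.val < s ∧ 𝔭 a b ≤ 𝔮 := by
    intro 𝔮 _ h𝔮
    obtain ⟨hu, hv, a, b, hab, hbs, ha, hb⟩ :=
      exists_mem_of_not_isRegularLocalRing_nodeDeformationRing_aux t hspan hdim s hprod hhprod.symm 𝔮 h𝔮
    refine ⟨a, b, hab, hbs, sup_le ?_ ?_⟩
    · rw [Ideal.map_le_iff_le_comap, Ideal.span_le]
      rintro z (rfl | rfl); exacts [ha, hb]
    · rw [Ideal.span_le]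
      rintro z (rfl | rfl); exacts [hu, hv]
  have hSing₂ : ∀ {a b : Fin (d - 1)}, a ≠ b → a.val < s → b.val < s →
      ∀ (𝔮 : Ideal (DeJong1996.NodeDeformationRing A hprod)) [𝔮.IsPrime],
        𝔭 a b ≤ 𝔮 → ¬ IsRegularLocalRing (Localization.AtPrime 𝔮) := by
    intro a b hab has hbs 𝔮 _ hle
    refine not_isRegularLocalRing_localization_nodeDeformationRing_of_dvd (hdvd_pair hab has hbs) 𝔮
      (hle (Ideal.mem_sup_right (Ideal.subset_span (by simp))))
      (hle (Ideal.mem_sup_right (Ideal.subset_span (by simp))))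
      (hle (Ideal.mem_sup_left (Ideal.mem_map_of_mem _ (Ideal.subset_span (by simp)))))
      (hle (Ideal.mem_sup_left (Ideal.mem_map_of_mem _ (Ideal.subset_span (by simp)))))
  have hinj : ∀ {a b a' b' : Fin (d - 1)}, a < b → b.val < s → a' < b' → b'.val < s →
      𝔭 a b ≤ 𝔭 a' b' → a = a' ∧ b = b' := by
    intro a b a' b' hab hbs hab' hb's hle
    exact eq_of_centreIdeal_le t hspan hdim hprod hab hab' (hmem_pair (lt_trans hab' hb's)) hle
  have hprime : ∀ {a b : Fin (d - 1)}, a ≠ b → a.val < s → (𝔭 a b).IsPrime := fun hab has =>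
    (isPrime_centreIdeal_nodeDeformationRing t hspan hdim hprod hab (hmem_pair has)).1
  let O := X.presheaf.stalk x
  let Ô := AdicCompletion (maximalIdeal O) O
  let c : O →+* Ô := algebraMap O Ô
  let Î : Closeds X → Ideal Ô := fun T => (stalkIdeal (vanishingIdeal T) x).map c
  have hÎU : ∀ (T : Closeds X) (U : X.affineOpens) (hU : x ∈ (U : X.Opens)),
      (completedStalkIdeal (vanishingIdeal T) x U hU).map e.toRingHom = (Î T).map e := by
    intro T U hU
    rw [completedStalkIdeal_eq_map_stalkIdeal]
    rfl
  have hÎmono : ∀ {T T' : Closeds X}, T ≤ T' → Î T' ≤ Î T := fun hTT' =>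
    Ideal.map_mono (stalkIdeal_mono (vanishingIdeal_antimono hTT') x)
  -- EGA IV₂ 7.8.3 (v) for `𝒪_{X,x}`
  have hReg : ∀ (𝔓 : Ideal Ô) [𝔓.IsPrime],
      IsRegularLocalRing (Localization.AtPrime 𝔓) ↔
        IsRegularLocalRing (Localization.AtPrime (𝔓.under O)) := fun 𝔓 _ =>
    (isRegularLocalRing_localization_adicCompletion_stalk_iff p x 𝔓).1
  -- F4: `V(Î_S) ⊆ Sing(Ô)`
  have F4 : ∀ (𝔓 : Ideal Ô) [𝔓.IsPrime], Î ⟨S, hS⟩ ≤ 𝔓 →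
      ¬ IsRegularLocalRing (Localization.AtPrime 𝔓) := by
    intro 𝔓 _ hle hreg
    have h1 : IsRegularLocalRing (Localization.AtPrime (𝔓.under O)) := (hReg 𝔓).mp hreg
    let 𝔮 : Spec O := ⟨𝔓.under O, inferInstance⟩
    have h2 := (isRegularLocalRing_localization_stalk_iff x 𝔮).mp h1
    have h3 : X.fromSpecStalk x 𝔮 ∈ ((⟨S, hS⟩ : Closeds X) : Set X) := by
      refine (fromSpecStalk_mem_iff_stalkIdeal_vanishingIdeal_le x ⟨S, hS⟩ 𝔮).mpr ?_
      change _ ≤ Ideal.comap c 𝔓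
      exact Ideal.map_le_iff_le_comap.mp hle
    exact h3 h2
  -- F5: `Ô ≅ model` on regularity of localisations
  have F5 : ∀ (𝔓 : Ideal Ô) [𝔓.IsPrime],
      IsRegularLocalRing (Localization.AtPrime 𝔓) ↔
        IsRegularLocalRing (Localization.AtPrime (𝔓.map e)) := fun 𝔓 _ =>
    (isRegularLocalRing_localization_map_ringEquiv_iff e 𝔓).symm
  -- Step α: every component through `x` has a prime completed ideal containing some `𝔭_{ab}`
  have stepα : ∀ E' (hE' : E' ∈ componentsIn S), x ∈ E' →
      (Î ⟨E', componentsIn.isClosed hS hE'⟩).IsPrime ∧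
        ∃ a b : Fin (d - 1), a < b ∧ b.val < s ∧ 𝔭 a b ≤ (Î ⟨E', componentsIn.isClosed hS hE'⟩).map e := by
    intro E' hE' hxE'
    have hE'c := componentsIn.isClosed hS hE'
    -- the reduced ORBIT of the component is a regular scheme, and near `x` it is `E'`
    obtain ⟨E'', hE'', hE''eq⟩ := id hE'
    have hE''eq : Subtype.val '' E'' = E' := hE''eq
    have hreg := h.isRegular_subscheme_orbit E'' hE''
    have hxsupp : x ∈ (vanishingIdeal ⟨closure (⋃ g : G, (ρ g).hom.base '' (Subtype.val '' E'')),
        isClosed_closure⟩).support := by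
      rw [← SetLike.mem_coe, Scheme.IdealSheafData.coe_support_vanishingIdeal]
      refine subset_closure (Set.mem_iUnion.mpr ⟨1, ?_⟩)
      rw [map_one, hE''eq]
      exact ⟨x, hxE', rfl⟩
    have hP₀ := isPrime_map_stalkIdeal_adicCompletion x hreg hxsupp
    have heqst : stalkIdeal (vanishingIdeal ⟨closure (⋃ g : G, (ρ g).hom.base '' (Subtype.val '' E'')),
        isClosed_closure⟩) x = stalkIdeal (vanishingIdeal ⟨E', hE'c⟩) x := by
      rw [stalkIdeal_vanishingIdeal_orbit_eq h hE'' (hE''eq ▸ hxE' : x ∈ Subtype.val '' E'')]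
      congr
    haveI hP : (Î ⟨E', hE'c⟩).IsPrime := by
      change ((stalkIdeal (vanishingIdeal ⟨E', hE'c⟩) x).map c).IsPrime
      rw [← heqst]
      exact hP₀
    refine ⟨hP, ?_⟩
    have hle : Î ⟨S, hS⟩ ≤ Î ⟨E', hE'c⟩ := hÎmono (componentsIn.subset ⟨E'', hE'', hE''eq⟩)
    have h1 := F4 (Î ⟨E', hE'c⟩) hle
    rw [F5] at h1
    exact hSing₁ _ h1
  -- Step β: every `𝔭_{ab}` is the completed ideal of some component through `x`
  have stepβ : ∀ a b : Fin (d - 1), a < b → b.val < s →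
      ∃ E'' : Set X, ∃ hE'' : E'' ∈ componentsIn S, x ∈ E'' ∧
        (Î ⟨E'', componentsIn.isClosed hS hE''⟩).map e = 𝔭 a b := by
    intro a b hab hbs
    have has : a.val < s := lt_trans hab hbs
    haveI := hprime hab.ne has
    let 𝔓 : Ideal Ô := (𝔭 a b).comap e
    haveI : 𝔓.IsPrime := Ideal.comap_isPrime e _
    have h𝔓map : 𝔓.map e = 𝔭 a b := Ideal.map_comap_of_surjective e e.surjective _
    have h1 : ¬ IsRegularLocalRing (Localization.AtPrime 𝔓) := by
      rw [F5]
      exact hSing₂ hab.ne has hbs (𝔓.map e) h𝔓map.ge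
    let 𝔮 : Spec O := ⟨𝔓.under O, inferInstance⟩
    have h2 : ¬ IsRegularLocalRing (X.presheaf.stalk (X.fromSpecStalk x 𝔮)) := fun hreg =>
      h1 ((hReg 𝔓).mpr ((isRegularLocalRing_localization_stalk_iff x 𝔮).mpr hreg))
    obtain ⟨E'', hE'', hqE''⟩ := componentsIn.exists_mem (S := S) h2
    have hE''c := componentsIn.isClosed hS hE''
    have hspec : X.fromSpecStalk x 𝔮 ⤳ x := Scheme.range_fromSpecStalk.le ⟨𝔮, rfl⟩
    have hxE'' : x ∈ E'' := hspec.mem_closed hE''c hqE''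
    refine ⟨E'', hE'', hxE'', ?_⟩
    have h3 : Î ⟨E'', hE''c⟩ ≤ 𝔓 := by
      rw [Ideal.map_le_iff_le_comap]
      exact (fromSpecStalk_mem_iff_stalkIdeal_vanishingIdeal_le x ⟨E'', hE''c⟩ 𝔮).mp hqE''
    obtain ⟨-, a', b', hab', hb's, h4⟩ := stepα E'' hE'' hxE''
    have h5 : (Î ⟨E'', hE''c⟩).map e ≤ 𝔭 a b := h𝔓map ▸ Ideal.map_mono h3
    obtain ⟨rfl, rfl⟩ := hinj hab' hb's hab hbs (h4.trans h5)
    exact le_antisymm h5 h4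
  -- Step γ: the completed ideal of a component through `x` IS some `𝔭_{ab}`
  have stepγ : ∀ E' (hE' : E' ∈ componentsIn S), x ∈ E' →
      ∃ a b : Fin (d - 1), a < b ∧ b.val < s ∧
        (Î ⟨E', componentsIn.isClosed hS hE'⟩).map e = 𝔭 a b := by
    intro E' hE' hxE'
    obtain ⟨-, a, b, hab, hbs, h1⟩ := stepα E' hE' hxE'
    obtain ⟨E'', hE'', hxE'', h2⟩ := stepβ a b hab hbs
    refine ⟨a, b, hab, hbs, ?_⟩
    have h3 : Î ⟨E'', componentsIn.isClosed hS hE''⟩ ≤ Î ⟨E', componentsIn.isClosed hS hE'⟩ := by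
      have := Ideal.comap_mono (f := e) (h2.le.trans h1)
      rwa [Ideal.comap_map_of_bijective e e.bijective,
        Ideal.comap_map_of_bijective e e.bijective] at this
    have h4 : stalkIdeal (vanishingIdeal ⟨E'', componentsIn.isClosed hS hE''⟩) x ≤
        stalkIdeal (vanishingIdeal ⟨E', componentsIn.isClosed hS hE'⟩) x := by
      have := Ideal.comap_mono (f := c) h3
      rwa [comap_map_stalk_adicCompletion, comap_map_stalk_adicCompletion] at this
    obtain rfl := eq_of_stalkIdeal_vanishingIdeal_le hS hE' hE'' hxE' h4
    exact h2
  -- assemble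
  refine ⟨fun E' hE' hxE' => ?_, fun a b hab hbs => ?_⟩
  · obtain ⟨a, b, hab, hbs, h1⟩ := stepγ E' hE' hxE'
    refine ⟨a, b, hab, hbs, fun U hU => ?_⟩
    rw [hÎU, show (⟨closure E', isClosed_closure⟩ : Closeds X) = ⟨E', componentsIn.isClosed hS hE'⟩
      from Closeds.ext (componentsIn.isClosed hS hE').closure_eq, h1]
  · obtain ⟨E'', hE'', hxE'', h1⟩ := stepβ a b hab hbs
    refine ⟨E'', hE'', hxE'', fun U hU => ?_⟩
    rw [hÎU, show (⟨closure E'', isClosed_closure⟩ : Closeds X) =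
      ⟨E'', componentsIn.isClosed hS hE''⟩ from Closeds.ext (componentsIn.isClosed hS hE'').closure_eq, h1]

/-! ## The orbit centre at a closed point -/

/-- The orbit of a translate is the orbit: `⋃_{g'} ρ(g')(ρ(g) V) = ⋃_{g'} ρ(g') V`. [folklore] -/
theorem iUnion_image_translate_eq {X : Scheme.{0}} {G : Type} [Group G] (ρ : G →* Aut X) (g : G)
    (V : Set X) :
    (⋃ g' : G, (ρ g').hom.base '' ((ρ g).hom.base '' V)) = ⋃ g' : G, (ρ g').hom.base '' V := by
  refine Set.Subset.antisymm (Set.iUnion_subset fun g' => ?_) (Set.iUnion_subset fun g' => ?_)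
  · rw [image_image_eq_of_action]
    exact Set.subset_iUnion (fun g' : G => (ρ g').hom.base '' V) (g' * g)
  · have : (ρ g').hom.base '' V = (ρ (g' * g⁻¹)).hom.base '' ((ρ g).hom.base '' V) := by
      rw [image_image_eq_of_action, inv_mul_cancel_right]
    rw [this]
    exact Set.subset_iUnion (fun g' : G => (ρ g').hom.base '' ((ρ g).hom.base '' V)) (g' * g⁻¹)

/-- **The orbit centre at a closed point is one singular component**: for a
`QuasiSplitNormalFormPair`, an irreducible component `E` of `Sing X` and a point `x` of the
orbit centre `C = closure (⋃_g ρ(g)(E))`, there is an irreducible component `T` of `Sing X`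
through `x` (the translate of `E` containing `x`) whose vanishing ideal sheaf has the same stalk
at `x` as that of `C`, hence the same completed ideals; with
`quasiSplitNormalFormPair_centreFormalIdeal` (1) the completed ideal of `C` at a singular closed
point is a centre ideal `𝔭_{ab}` of the model. [cite: DeJong1997, proof of Prop. 5.11, p. 619] -/
theorem quasiSplitNormalFormPair_centreFormalIdeal_orbit {k : Type} [Field k] {X : Scheme.{0}}
    {p : X ⟶ Spec (.of k)} {Z : Set X} {G : Type} [Group G] [Finite G] {ρ : G →* Aut X} {d : ℕ}
    (h : DeJong1997.QuasiSplitNormalFormPair p Z ρ d)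
    {E : Set ↥({x : X | ¬ IsRegularLocalRing (X.presheaf.stalk x)} : Set X)}
    (hE : E ∈ irreducibleComponents ↥({x : X | ¬ IsRegularLocalRing (X.presheaf.stalk x)} : Set X))
    {x : X} (hx : x ∈ closure (⋃ g : G, (ρ g).hom.base '' (Subtype.val '' E))) :
    ∃ T ∈ componentsIn ({x : X | ¬ IsRegularLocalRing (X.presheaf.stalk x)} : Set X), x ∈ T ∧
      T ⊆ closure (⋃ g : G, (ρ g).hom.base '' (Subtype.val '' E)) ∧
      stalkIdeal (vanishingIdeal ⟨closure (⋃ g : G, (ρ g).hom.base '' (Subtype.val '' E)),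
          isClosed_closure⟩) x =
        stalkIdeal (vanishingIdeal ⟨closure T, isClosed_closure⟩) x ∧
      ∀ (U : X.affineOpens) (hU : x ∈ (U : X.Opens)),
        completedStalkIdeal (vanishingIdeal ⟨closure (⋃ g : G, (ρ g).hom.base '' (Subtype.val '' E)),
          isClosed_closure⟩) x U hU =
        completedStalkIdeal (vanishingIdeal ⟨closure T, isClosed_closure⟩) x U hU := by
  have hS := h.isClosed_setOf_not_isRegularLocalRing
  have hE₀ := componentsIn.image_val_mem hE
  -- the translate through `x`
  obtain ⟨g, hxg⟩ := Set.mem_iUnion.mp ((quasiSplitNormalFormPair_closure_orbit_eq h hE).le hx)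
  have hT := image_mem_componentsIn_singularLocus ρ g hE₀
  obtain ⟨E₁, hE₁, hE₁eq⟩ := id hT
  have hE₁eq : Subtype.val '' E₁ = (ρ g).hom.base '' (Subtype.val '' E) := hE₁eq
  have hTc : IsClosed ((ρ g).hom.base '' (Subtype.val '' E)) := componentsIn.isClosed hS hT
  -- the two orbits agree
  have horb : closure (⋃ g' : G, (ρ g').hom.base '' (Subtype.val '' E₁)) =
      closure (⋃ g' : G, (ρ g').hom.base '' (Subtype.val '' E)) := by
    rw [hE₁eq, iUnion_image_translate_eq]
  have hst : stalkIdeal (vanishingIdeal ⟨closure (⋃ g : G, (ρ g).hom.base '' (Subtype.val '' E)),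
        isClosed_closure⟩) x =
      stalkIdeal (vanishingIdeal ⟨closure ((ρ g).hom.base '' (Subtype.val '' E)),
        isClosed_closure⟩) x := by
    have h1 := stalkIdeal_vanishingIdeal_orbit_eq h hE₁ (hE₁eq ▸ hxg : x ∈ Subtype.val '' E₁)
    have h2 : (⟨closure (⋃ g' : G, (ρ g').hom.base '' (Subtype.val '' E₁)), isClosed_closure⟩ :
        Closeds X) = ⟨closure (⋃ g' : G, (ρ g').hom.base '' (Subtype.val '' E)), isClosed_closure⟩ :=
      Closeds.ext horb
    have h3 : (⟨Subtype.val '' E₁, isClosed_image_val_of_mem_irreducibleComponents hS hE₁⟩ :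
        Closeds X) = ⟨closure ((ρ g).hom.base '' (Subtype.val '' E)), isClosed_closure⟩ :=
      Closeds.ext (by rw [Closeds.coe_mk, Closeds.coe_mk, hE₁eq, hTc.closure_eq])
    rw [h2, h3] at h1
    exact h1
  refine ⟨_, hT, hxg, ?_, hst, fun U hU => ?_⟩
  · rw [quasiSplitNormalFormPair_closure_orbit_eq h hE]
    exact Set.subset_iUnion (fun g : G => (ρ g).hom.base '' (Subtype.val '' E)) g
  · rw [completedStalkIdeal_eq_map_stalkIdeal, completedStalkIdeal_eq_map_stalkIdeal, hst]

end Summit.ResolutionOfSingularities.ResolutionOfSingularities.Theorems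

end
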